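import Summits.NavierStokesRegularity.NavierStokesRegularity.Theorems.ExtremiserTransienceWeakClassGradTypeI
import Summits.NavierStokesRegularity.NavierStokesRegularity.Theorems.ExtremiserTransienceWeakClassHigherTypeI
import Literature.Analysis.FluidPDE.TsaiLocalPressureSup
import Literature.Analysis.Calculus.DifferenceQuotientHolder
import HarnessLib

/-!
# Route `ExtremiserTransience`, LINE g5-α repair (seat ns-idea-5 g5): Type-I decay of the pressure source of weak-class fields

`--supports stmt-NavierStokesRegularity-27823` (the subcubic local energy budget, p639422).  Route-independent module.  For a member `(W, K)` of the
weak one-slice class, the quadratic pressure source `G[W σ] = ∂ᵢ∂ⱼ(WᵢWⱼ)(σ, ·)` (`pressureSource`) obeys `σ² |G[W σ](x)| ≤ K_G` for all `σ < 0`, `x`: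
the pointwise bound `|G[v]| ≤ 2T‖D²v‖‖v‖ + (T+T²)‖Dv‖²` (`abs_pressureSource_le`, Tsai) with the Type-I bounds `√(−σ)‖W‖ ≤ K`, `(−σ)‖DW‖ ≤ K₁`
(`weakClass_gradTypeI`, p638606) and `(−σ)^{3/2}‖D²W‖ ≤ K₂` (`weakClass_hessTypeI`, p639637).  USE: this is the hypothesis `hG` (on every window
`(t₁, t₂)`, `t₂ < 0`, with `N_G = K_G/t₂²`) of `pressure_eq_pressurePotentialMod_add_const_of_oseenMild` and of `exists_abs_pressurePotentialMod_sub_le`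
in recipe steps 2 and 4 of the 27823 budget (line card §RECIPE).  HONEST FRAMING: regularity bookkeeping for hypothetical blow-up limits; nothing about
Navier–Stokes regularity or blow-up is proved here and no summit is proved by a line. [folklore]
-/

namespace Summit.NavierStokesRegularity.NavierStokesRegularity.Theorems.ExtremiserTransience
set_option linter.dupNamespace false

open Set Function MeasureTheory Filter Topology
open scoped RealInnerProductSpace ContDiff
open Literature.Analysis Literature.Analysis.FluidPDE Literature.Analysis.Calculus

/-- **`σ² |pressureSource (W σ) x| ≤ K_G`** for weak-class fields. [folklore] -/
theorem weakClass_pressureSourceTypeI (W : ℝ → EuclideanSpace ℝ (Fin 3) → EuclideanSpace ℝ (Fin 3)) (K : ℝ)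
    (hcont : ContinuousOn (Function.uncurry W) (Set.Iio (0 : ℝ) ×ˢ Set.univ))
    (hmild : ∀ s t : ℝ, s < t → t < 0 → ∀ x, W t x =
      Literature.Analysis.FluidPDE.heatFlow (W s) (t - s) x - Literature.Analysis.FluidPDE.oseenDuhamel 1 s W W t x)
    (hdec : ∀ t : ℝ, t < 0 → ∀ x, Real.sqrt (-t) * ‖W t x‖ ≤ K) :
    ∃ KG : ℝ, 0 ≤ KG ∧ ∀ σ < 0, ∀ x, σ ^ 2 * |pressureSource (W σ) x| ≤ KG := by
  obtain ⟨K₁, hK₁, hg⟩ := weakClass_gradTypeI W K hcont hmild hdec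
  obtain ⟨K₂, hK₂, hh⟩ := weakClass_hessTypeI W K hcont hmild hdec
  have hK : 0 ≤ K := by
    have h := hdec (-1) (by norm_num) 0
    have h1 : Real.sqrt (-(-1 : ℝ)) = 1 := by norm_num
    rw [h1, one_mul] at h
    exact (norm_nonneg _).trans h
  set T : ℝ := ‖(Literature.Analysis.FluidPDE.traceCLM :
    (EuclideanSpace ℝ (Fin 3) →L[ℝ] EuclideanSpace ℝ (Fin 3)) →L[ℝ] ℝ)‖ with hT
  have hT0 : 0 ≤ T := by
    rw [hT]
    exact norm_nonneg (Literature.Analysis.FluidPDE.traceCLM :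
      (EuclideanSpace ℝ (Fin 3) →L[ℝ] EuclideanSpace ℝ (Fin 3)) →L[ℝ] ℝ)
  refine ⟨2 * T * K₂ * K + (T + T ^ 2) * K₁ ^ 2, by positivity, fun σ hσ x => ?_⟩
  have hσ0 : (0:ℝ) < -σ := by linarith
  have hss : Real.sqrt (-σ) * Real.sqrt (-σ) = -σ := Real.mul_self_sqrt hσ0.le
  have hcd : ContDiff ℝ 2 (W σ) := contDiff_infty.1 (hg σ hσ).1 2
  have h := abs_pressureSource_le hcd x
  -- the three Type-I bounds at `(σ, x)`
  have hW : Real.sqrt (-σ) * ‖W σ x‖ ≤ K := hdec σ hσ x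
  have hD : (-σ) * ‖fderiv ℝ (W σ) x‖ ≤ K₁ := (hg σ hσ).2 x
  have hF : (-σ) * Real.sqrt (-σ) * ‖fderiv ℝ (fderiv ℝ (W σ)) x‖ ≤ K₂ :=
    le_trans (mul_le_mul_of_nonneg_left (norm_fderiv_fderiv_le_norm_iteratedFDeriv_two (W σ) x) (by positivity))
      (hh σ hσ x)
  -- first term
  have A1 : σ ^ 2 * (2 * T * ‖fderiv ℝ (fderiv ℝ (W σ)) x‖ * ‖W σ x‖) ≤ 2 * T * K₂ * K := by
    have e : σ ^ 2 * (2 * T * ‖fderiv ℝ (fderiv ℝ (W σ)) x‖ * ‖W σ x‖) =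
        2 * T * ((-σ) * Real.sqrt (-σ) * ‖fderiv ℝ (fderiv ℝ (W σ)) x‖) * (Real.sqrt (-σ) * ‖W σ x‖) := by
      have : σ ^ 2 = (-σ) * (Real.sqrt (-σ) * Real.sqrt (-σ)) := by rw [hss]; ring
      rw [this]; ring
    rw [e]
    have h2 : 0 ≤ Real.sqrt (-σ) * ‖W σ x‖ := by positivity
    calc 2 * T * ((-σ) * Real.sqrt (-σ) * ‖fderiv ℝ (fderiv ℝ (W σ)) x‖) * (Real.sqrt (-σ) * ‖W σ x‖)
        ≤ 2 * T * K₂ * (Real.sqrt (-σ) * ‖W σ x‖) := by gcongr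
      _ ≤ 2 * T * K₂ * K := by gcongr
  -- second term
  have A2 : σ ^ 2 * ((T + T ^ 2) * ‖fderiv ℝ (W σ) x‖ ^ 2) ≤ (T + T ^ 2) * K₁ ^ 2 := by
    have e : σ ^ 2 * ((T + T ^ 2) * ‖fderiv ℝ (W σ) x‖ ^ 2) = (T + T ^ 2) * ((-σ) * ‖fderiv ℝ (W σ) x‖) ^ 2 := by ring
    rw [e]
    have hsq : ((-σ) * ‖fderiv ℝ (W σ) x‖) ^ 2 ≤ K₁ ^ 2 := pow_le_pow_left₀ (by positivity) hD 2
    exact mul_le_mul_of_nonneg_left hsq (by positivity)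
  calc σ ^ 2 * |pressureSource (W σ) x|
      ≤ σ ^ 2 * (2 * T * ‖fderiv ℝ (fderiv ℝ (W σ)) x‖ * ‖W σ x‖ + (T + T ^ 2) * ‖fderiv ℝ (W σ) x‖ ^ 2) :=
        mul_le_mul_of_nonneg_left h (sq_nonneg σ)
    _ = σ ^ 2 * (2 * T * ‖fderiv ℝ (fderiv ℝ (W σ)) x‖ * ‖W σ x‖) + σ ^ 2 * ((T + T ^ 2) * ‖fderiv ℝ (W σ) x‖ ^ 2) := by
        ring
    _ ≤ 2 * T * K₂ * K + (T + T ^ 2) * K₁ ^ 2 := add_le_add A1 A2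

/-- **Window form**: on `(t₁, t₂)` with `t₂ < 0`, `|pressureSource (W σ) x| ≤ K_G / t₂²` — the shape of the hypothesis `hG` of the tree's
pressure identification / oscillation theorems. [folklore] -/
theorem weakClass_pressureSource_window (W : ℝ → EuclideanSpace ℝ (Fin 3) → EuclideanSpace ℝ (Fin 3)) (K : ℝ)
    (hcont : ContinuousOn (Function.uncurry W) (Set.Iio (0 : ℝ) ×ˢ Set.univ))
    (hmild : ∀ s t : ℝ, s < t → t < 0 → ∀ x, W t x =
      Literature.Analysis.FluidPDE.heatFlow (W s) (t - s) x - Literature.Analysis.FluidPDE.oseenDuhamel 1 s W W t x)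
    (hdec : ∀ t : ℝ, t < 0 → ∀ x, Real.sqrt (-t) * ‖W t x‖ ≤ K) :
    ∃ KG : ℝ, 0 ≤ KG ∧ ∀ t₁ t₂ : ℝ, t₂ < 0 → ∀ σ ∈ Set.Ioo t₁ t₂, ∀ x, |pressureSource (W σ) x| ≤ KG / t₂ ^ 2 := by
  obtain ⟨KG, hKG, h⟩ := weakClass_pressureSourceTypeI W K hcont hmild hdec
  refine ⟨KG, hKG, fun t₁ t₂ ht₂ σ hσ x => ?_⟩
  have hσ0 : σ < 0 := hσ.2.trans ht₂
  have hsq : t₂ ^ 2 ≤ σ ^ 2 := by nlinarith [hσ.2]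
  have ht2 : 0 < t₂ ^ 2 := sq_pos_of_neg ht₂
  rw [le_div_iff₀ ht2]
  calc |pressureSource (W σ) x| * t₂ ^ 2 ≤ |pressureSource (W σ) x| * σ ^ 2 :=
        mul_le_mul_of_nonneg_left hsq (abs_nonneg _)
    _ = σ ^ 2 * |pressureSource (W σ) x| := mul_comm _ _
    _ ≤ KG := h σ hσ0 x
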